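import Summits.QuantumFields.BalabanUV.T4Continuum.Support.CTConjugationTorus
import Summits.QuantumFields.BalabanUV.T4Continuum.Support.CTWeightedEnergy
import Summits.QuantumFields.BalabanUV.T4Continuum.Support.ScalarLayerFreeInputs

/-!
# T⁴ programme, SUBSTRATE (shared lattice-gauge analysis library) — LEVEL-FREE CONJUGATION BOUNDS OF THE `U = 1` SCALAR AVERAGED GREEN FUNCTION
# `G′ = (Δ + a′Π′)⁻¹` AND OF ITS GRADIENT SANDWICHES `∂G′`, `G′∂ᴴ`, `∂G′∂ᴴ` (programme VEC, file 3b: the instance of `CTWeightedEnergy` at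
# `A = ScalarAveragedPropagator.DeltaPs`, `X = ∂`, `Y = a′Π′`)

Substrate cell `b2b-balaban-substrate-*`, seat p3.  With a site weight `ρ₀` on `Tor (fine n M)` that is `1/n`-Lipschitz along fine bonds and oscillates by
`≤ Λ` on blocks (e.g. `ScalarCovariantCoercive.rhoS`, `Λ = 1`), bond weight `bondW₀ ρ₀ (x,ν) = ρ₀ x`:
 * §1 the `cosh` ROW DEFECTS of the free pieces ([folklore]): **`LapS_apply`** (entries of `Δ = Σ_ν ∂_ν^*∂_ν`), **`ctRowDefect_LapS_le`**
   (`≤ d·κ²·e^{κ²/2}`, via `DeltaACombesThomas.sq_mul_cosh_div_sub_one_le`), **`ctRowDefect_PiS_le`** (`≤ cosh(κΛ) − 1`), hence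
   **`ctRowDefect_DeltaPs_le`**: `defect(Δ′) ≤ Jfree d a′ κ Λ := d·κ²e^{κ²/2} + a′(cosh(κΛ) − 1)` — free of `n` and of the torus;
 * §2 **`conjDefect_DeltaPs`** and **`wCoercive_DeltaPs`**: `WCoercive (DeltaPs n M a′) κ ρ₀ (γ′ − Jfree)`, `γ′ = gammaPs d a′`
   (`ScalarLayerFreeInputs.coercive_DeltaPs` + `CTWeightedCoercivity.wCoercive_of_coercive`);
 * §3 the CONJUGATION BOUNDS, with `γw = γ′ − Jfree > 0`, `J = Jfree`, `c₁ = 2√d·|κ|·e^{|κ|}` (`CTConjugationTorus.opNorm_conjMat_GradOp_sub_le`):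
   **`opNorm_conjMat_Gps_le`** `‖cG′‖ ≤ 1/γw`; **`opNorm_GradOp_conjMat_Gps_le`** `‖∂·cG′‖ ≤ √(1/γw + J/γw²)`; **`opNorm_conjMat_GradOp_Gps_le`**
   `‖c(∂G′)‖ ≤ √(1/γw + J/γw²) + c₁/γw`; **`opNorm_conjMat_Gps_GradOpH_le`** `‖c(G′∂ᴴ)‖ ≤ K₂`; **`opNorm_GradOp_conjMat_Gps_GradOpH_le`**
   `‖∂·c(G′∂ᴴ)‖ ≤ K₁`; **`opNorm_conjMat_GradOp_Gps_GradOpH_le`** `‖c(∂G′∂ᴴ)‖ ≤ K₁ + c₁K₂` (`K₁ = CTWeightedEnergy.K1 γw J c₁`, `K₂ = K2 γw J c₁`).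
Every constant depends on `(d, a′, κ, Λ)` only — the inputs of the conjugation bounds of `Q̃′G′`, `Kcomp = Q̃′G′G′Q̃′ᴴ` and of the projection term
`∂·Pone·∂ᴴ = ∂·PcT·∂ᴴ` (files VEC-4∕5), hence of `WCoercive (B5DeltaA169.DeltaA)` (VEC-6).

HONEST FRAMING (T4-DAG p. 1).  `U = 1` lattice linear algebra ([folklore]); no estimate of any NE row; nothing printed is a hypothesis or a conclusion;
no `def … : Prop` fact (one real constant `Jfree`); spine 0/9 unchanged; NOT infinite volume ∕ mass gap ∕ Clay.  HONEST DEPENDENCY: continuum YM on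
T⁴ ⇐ BetaPertH ∧ nine spine estimates (0/9 proved); BetaPertH ⇐ (D1) ∧ (D4) ∧ CAP+tail; G-an2-4 gates asym, D1 and NE2/3/4.  ABSOLUTE RULE kept; no `sorry`.
-/

noncomputable section

open scoped BigOperators ComplexConjugate Matrix Matrix.Norms.L2Operator ComplexOrder

namespace Summit.QuantumFields.BalabanUV.T4Continuum.CTScalarGreen

open Literature.MathematicalPhysics.QuantumFieldTheory.Balaban1983to89.B5Prop11Plancherel (Tor fine unitVec)
open Literature.MathematicalPhysics.QuantumFieldTheory.Balaban1983to89.B5Action121 (LapS GradOp LapS_mulVec)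
open Literature.MathematicalPhysics.QuantumFieldTheory.Balaban1983to89.B5Blocks16 (blockOf)
open Literature.MathematicalPhysics.QuantumFieldTheory.Balaban1983to89.Beta.DeltaACombesThomas (ctWeight ctRowDefect ctWeight_nonneg ctWeight_self
  ctRowDefect_add_le ctRowDefect_smul ctRowDefect_le_of_norm_le sq_mul_cosh_div_sub_one_le)
open Summit.QuantumFields.BalabanUV.T4Continuum
open Summit.QuantumFields.BalabanUV.T4Continuum.CoerciveInverseTower (Coercive)
open Summit.QuantumFields.BalabanUV.T4Continuum.ScalarBlockPoincare (PiS)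
open Summit.QuantumFields.BalabanUV.T4Continuum.ScalarAveragedPropagator (DeltaPs Gps gammaPs gammaPs_pos DeltaPs_isHermitian)
open Summit.QuantumFields.BalabanUV.T4Continuum.ScalarLayerFreeInputs (DeltaPs_eq_gram smul_PiS_posSemidef coercive_DeltaPs)
open Summit.QuantumFields.BalabanUV.T4Continuum.ScalarCovariantCTDefects (ctWeight_le_of_abs_le PiS_apply sum_ite_blockOf_eq)
open Summit.QuantumFields.BalabanUV.T4Continuum.CTWeightedCoercivity
open Summit.QuantumFields.BalabanUV.T4Continuum.CTConjugationPieces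
open Summit.QuantumFields.BalabanUV.T4Continuum.CTConjugationTorus
open Summit.QuantumFields.BalabanUV.T4Continuum.CTWeightedEnergy

variable {d : ℕ} (n : ℕ) [NeZero n] (M : Fin d → ℕ) [hM : ∀ μ, NeZero (M μ)]

/-! ## §1 Row defects of the free pieces -/

section Defects

variable {ρ₀ : Tor (fine n M) → ℝ} {κ : ℝ}

/-- **entries of the scalar Laplacian**: `Δ(x, y) = Σ_ν |n|²·(2[x = y] − [x + e_ν = y] − [x − e_ν = y])`. [folklore] -/
theorem LapS_apply (x y : Tor (fine n M)) :
    LapS (fine n M) ((n : ℕ) : ℂ) x y = ∑ ν : Fin d, conj ((n : ℕ) : ℂ) * ((n : ℕ) : ℂ) *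
      (2 * (if x = y then 1 else 0) - (if x + unitVec (fine n M) ν = y then 1 else 0) - (if x - unitVec (fine n M) ν = y then 1 else 0)) := by
  have h : LapS (fine n M) ((n : ℕ) : ℂ) x y = (LapS (fine n M) ((n : ℕ) : ℂ) *ᵥ Pi.single y (1 : ℂ)) x := by
    rw [Matrix.mulVec_single_one]; rfl
  rw [h, LapS_mulVec]
  refine Finset.sum_congr rfl fun ν _ => ?_
  simp only [Pi.single_apply]

/-- the entries are dominated by `n²·(2[x = y] + [x + e_ν = y] + [x − e_ν = y])` summed over `ν`. [folklore] -/
theorem norm_LapS_apply_le (x y : Tor (fine n M)) :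
    ‖LapS (fine n M) ((n : ℕ) : ℂ) x y‖ ≤ ∑ ν : Fin d, (n : ℝ) ^ 2 *
      (2 * (if x = y then 1 else 0) + (if x + unitVec (fine n M) ν = y then 1 else 0) + (if x - unitVec (fine n M) ν = y then 1 else 0)) := by
  rw [LapS_apply]
  refine (norm_sum_le _ _).trans (Finset.sum_le_sum fun ν _ => ?_)
  rw [norm_mul, norm_mul, Complex.norm_conj, Complex.norm_natCast, ← sq]
  refine mul_le_mul_of_nonneg_left ?_ (sq_nonneg _)
  refine (norm_sub_le _ _).trans (add_le_add ((norm_sub_le _ _).trans (add_le_add ?_ ?_)) ?_)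
  · rw [norm_mul, Complex.norm_two]; split_ifs <;> simp
  · split_ifs <;> simp
  · split_ifs <;> simp

/-- **ROW DEFECT OF THE SCALAR LAPLACIAN**, `n`-uniform: for a `1/n`-Lipschitz site weight, `defect_{κ,ρ₀}(Δ)(x) ≤ d·κ²·e^{κ²/2}`. [folklore] -/
theorem ctRowDefect_LapS_le (hlip : ∀ x ν, |ρ₀ (x + unitVec (fine n M) ν) - ρ₀ x| ≤ 1 / n) (x : Tor (fine n M)) :
    ctRowDefect (LapS (fine n M) ((n : ℕ) : ℂ)) κ ρ₀ x ≤ d * κ ^ 2 * Real.exp (κ ^ 2 / 2) := by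
  have hn1 : 1 ≤ n := Nat.one_le_iff_ne_zero.mpr (NeZero.ne n)
  have hw : ∀ ν, ctWeight κ ρ₀ x (x + unitVec (fine n M) ν) ≤ Real.cosh (κ / n) - 1 ∧ ctWeight κ ρ₀ x (x - unitVec (fine n M) ν) ≤ Real.cosh (κ / n) - 1 := by
    intro ν
    have e : κ * (1 / (n : ℝ)) = κ / n := by ring
    constructor
    · have h := ctWeight_le_of_abs_le κ ρ₀ (e := x) (e' := x + unitVec (fine n M) ν) (ℓ := 1 / n) (by rw [abs_sub_comm]; exact hlip x ν)
      rwa [e] at h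
    · have h0 := hlip (x - unitVec (fine n M) ν) ν
      rw [sub_add_cancel] at h0
      have h := ctWeight_le_of_abs_le κ ρ₀ (e := x) (e' := x - unitVec (fine n M) ν) (ℓ := 1 / n) h0
      rwa [e] at h
  have hcosh := sq_mul_cosh_div_sub_one_le n κ hn1
  set K : Tor (fine n M) → Tor (fine n M) → ℝ := fun x y => ∑ ν : Fin d, (n : ℝ) ^ 2 *
    (2 * (if x = y then 1 else 0) + (if x + unitVec (fine n M) ν = y then 1 else 0) + (if x - unitVec (fine n M) ν = y then 1 else 0)) with hK
  -- per direction: `Σ_y n²(2[x=y] + [x+e_ν=y] + [x−e_ν=y])·w(x,y) = n²(w(x,x+e_ν) + w(x,x−e_ν))` (`w(x,x) = 0`)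
  have hν : ∀ ν : Fin d, ∑ y, (n : ℝ) ^ 2 * (2 * (if x = y then 1 else 0) + (if x + unitVec (fine n M) ν = y then 1 else 0)
      + (if x - unitVec (fine n M) ν = y then 1 else 0)) * ctWeight κ ρ₀ x y
      = (n : ℝ) ^ 2 * (ctWeight κ ρ₀ x (x + unitVec (fine n M) ν) + ctWeight κ ρ₀ x (x - unitVec (fine n M) ν)) := by
    intro ν
    have h1 : ∀ y, (n : ℝ) ^ 2 * (2 * (if x = y then 1 else 0) + (if x + unitVec (fine n M) ν = y then 1 else 0)
        + (if x - unitVec (fine n M) ν = y then 1 else 0)) * ctWeight κ ρ₀ x y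
        = (n : ℝ) ^ 2 * (2 * (if x = y then ctWeight κ ρ₀ x y else 0) + (if x + unitVec (fine n M) ν = y then ctWeight κ ρ₀ x y else 0)
          + (if x - unitVec (fine n M) ν = y then ctWeight κ ρ₀ x y else 0)) := by
      intro y; split_ifs <;> ring
    rw [Finset.sum_congr rfl fun y _ => h1 y, ← Finset.mul_sum, Finset.sum_add_distrib, Finset.sum_add_distrib, ← Finset.mul_sum,
      Finset.sum_ite_eq, Finset.sum_ite_eq, Finset.sum_ite_eq]
    simp [ctWeight_self]
  calc ctRowDefect (LapS (fine n M) ((n : ℕ) : ℂ)) κ ρ₀ x ≤ ∑ y, K x y * ctWeight κ ρ₀ x y :=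
        ctRowDefect_le_of_norm_le _ K κ ρ₀ x fun y => by rw [hK]; exact norm_LapS_apply_le n M x y
    _ = ∑ ν : Fin d, (n : ℝ) ^ 2 * (ctWeight κ ρ₀ x (x + unitVec (fine n M) ν) + ctWeight κ ρ₀ x (x - unitVec (fine n M) ν)) := by
        simp only [hK, Finset.sum_mul]
        rw [Finset.sum_comm]
        exact Finset.sum_congr rfl fun ν _ => hν ν
    _ ≤ ∑ _ν : Fin d, (n : ℝ) ^ 2 * (2 * (Real.cosh (κ / n) - 1)) :=
        Finset.sum_le_sum fun ν _ => mul_le_mul_of_nonneg_left (by linarith [(hw ν).1, (hw ν).2]) (sq_nonneg _)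
    _ = 2 * d * ((n : ℝ) ^ 2 * (Real.cosh (κ / n) - 1)) := by rw [Finset.sum_const, Finset.card_univ, Fintype.card_fin, nsmul_eq_mul]; ring
    _ ≤ 2 * d * (κ ^ 2 / 2 * Real.exp (κ ^ 2 / 2)) := mul_le_mul_of_nonneg_left hcosh (by positivity)
    _ = d * κ ^ 2 * Real.exp (κ ^ 2 / 2) := by ring

/-- **ROW DEFECT OF THE BLOCK-MEAN PROJECTOR**: block oscillation `≤ Λ` gives `defect_{κ,ρ₀}(Π′)(x) ≤ cosh(κΛ) − 1` (`n^{−d}` against `n^d` sites).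
[folklore] -/
theorem ctRowDefect_PiS_le {Λ : ℝ} (hosc : ∀ x x', blockOf n M x = blockOf n M x' → |ρ₀ x - ρ₀ x'| ≤ Λ) (x : Tor (fine n M)) :
    ctRowDefect (PiS n M) κ ρ₀ x ≤ Real.cosh (κ * Λ) - 1 := by
  have hn0 : (0 : ℝ) < (n : ℝ) ^ d := pow_pos (by exact_mod_cast Nat.pos_of_ne_zero (NeZero.ne n)) d
  have hw0 : 0 ≤ Real.cosh (κ * Λ) - 1 := by linarith [Real.one_le_cosh (κ * Λ)]
  have hentry : ∀ x' : Tor (fine n M), ‖PiS n M x x'‖ ≤ if blockOf n M x' = blockOf n M x then ((n : ℝ) ^ d)⁻¹ else 0 := by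
    intro x'
    rw [PiS_apply]
    by_cases h : blockOf n M x = blockOf n M x'
    · rw [if_pos h, if_pos h.symm, norm_div, norm_one, norm_pow, Complex.norm_natCast, one_div]
    · rw [if_neg h, if_neg (Ne.symm h), norm_zero]
  calc ctRowDefect (PiS n M) κ ρ₀ x ≤ ∑ x', (if blockOf n M x' = blockOf n M x then ((n : ℝ) ^ d)⁻¹ else 0) * ctWeight κ ρ₀ x x' :=
        ctRowDefect_le_of_norm_le _ (fun z x' => if blockOf n M x' = blockOf n M z then ((n : ℝ) ^ d)⁻¹ else 0) κ ρ₀ x hentry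
    _ ≤ ∑ x' : Tor (fine n M), (if blockOf n M x' = blockOf n M x then ((n : ℝ) ^ d)⁻¹ * (Real.cosh (κ * Λ) - 1) else 0) := by
        refine Finset.sum_le_sum fun x' _ => ?_
        split_ifs with h
        · exact mul_le_mul_of_nonneg_left (ctWeight_le_of_abs_le κ ρ₀ (hosc x x' h.symm)) (by positivity)
        · rw [zero_mul]
    _ = Real.cosh (κ * Λ) - 1 := by rw [sum_ite_blockOf_eq n M (blockOf n M x), ← mul_assoc, mul_inv_cancel₀ hn0.ne', one_mul]

/-- the FREE ROW-DEFECT BUDGET `Jfree d a′ κ Λ = d·κ²·e^{κ²/2} + a′·(cosh(κΛ) − 1)`. [folklore] -/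
def Jfree (d : ℕ) (a' κ Λ : ℝ) : ℝ := d * κ ^ 2 * Real.exp (κ ^ 2 / 2) + a' * (Real.cosh (κ * Λ) - 1)

/-- `Jfree ≥ 0`. [folklore] -/
theorem Jfree_nonneg (d : ℕ) {a' : ℝ} (ha' : 0 ≤ a') (κ Λ : ℝ) : 0 ≤ Jfree d a' κ Λ := by
  have : 0 ≤ Real.cosh (κ * Λ) - 1 := by linarith [Real.one_le_cosh (κ * Λ)]
  unfold Jfree; positivity

/-- `Jfree` vanishes at `κ = 0`. [folklore] -/
theorem Jfree_zero (d : ℕ) (a' Λ : ℝ) : Jfree d a' 0 Λ = 0 := by simp [Jfree]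

/-- **ROW DEFECT OF `Δ′ = Δ + a′Π′`**: `≤ Jfree d a′ κ Λ`, free of `n` and of the torus. [folklore] -/
theorem ctRowDefect_DeltaPs_le {a' Λ : ℝ} (ha' : 0 ≤ a') (hlip : ∀ x ν, |ρ₀ (x + unitVec (fine n M) ν) - ρ₀ x| ≤ 1 / n)
    (hosc : ∀ x x', blockOf n M x = blockOf n M x' → |ρ₀ x - ρ₀ x'| ≤ Λ) (x : Tor (fine n M)) :
    ctRowDefect (DeltaPs n M a') κ ρ₀ x ≤ Jfree d a' κ Λ := by
  rw [DeltaPs]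
  refine (ctRowDefect_add_le _ _ κ ρ₀ x).trans ?_
  rw [ctRowDefect_smul, Complex.norm_real, Real.norm_of_nonneg ha', Jfree]
  exact add_le_add (ctRowDefect_LapS_le n M hlip x) (mul_le_mul_of_nonneg_left (ctRowDefect_PiS_le n M hosc x) ha')

end Defects

/-! ## §2 Weighted coercivity of `Δ′` -/

section Coercivity

variable {ρ₀ : Tor (fine n M) → ℝ} {κ a' Λ : ℝ}

/-- **conjugation defect of `Δ′`**: `ConjDefect (DeltaPs n M a′) κ ρ₀ (Jfree d a′ κ Λ)`. [folklore] -/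
theorem conjDefect_DeltaPs (ha' : 0 ≤ a') (hlip : ∀ x ν, |ρ₀ (x + unitVec (fine n M) ν) - ρ₀ x| ≤ 1 / n)
    (hosc : ∀ x x', blockOf n M x = blockOf n M x' → |ρ₀ x - ρ₀ x'| ≤ Λ) : ConjDefect (DeltaPs n M a') κ ρ₀ (Jfree d a' κ Λ) :=
  conjDefect_of_rowDefect (DeltaPs_isHermitian n M a') fun x => ctRowDefect_DeltaPs_le n M ha' hlip hosc x

/-- **WEIGHTED COERCIVITY OF `Δ′`**: `WCoercive (DeltaPs n M a′) κ ρ₀ (γ′ − Jfree)`. [folklore] -/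
theorem wCoercive_DeltaPs (ha' : 0 < a') (hlip : ∀ x ν, |ρ₀ (x + unitVec (fine n M) ν) - ρ₀ x| ≤ 1 / n)
    (hosc : ∀ x x', blockOf n M x = blockOf n M x' → |ρ₀ x - ρ₀ x'| ≤ Λ) :
    WCoercive (DeltaPs n M a') κ ρ₀ (gammaPs d a' - Jfree d a' κ Λ) :=
  wCoercive_of_coercive (coercive_DeltaPs n M ha') (conjDefect_DeltaPs n M ha'.le hlip hosc)

end Coercivity

/-! ## §3 The conjugation bounds of `G′`, `∂G′`, `G′∂ᴴ`, `∂G′∂ᴴ` -/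

section Bounds

variable {ρ₀ : Tor (fine n M) → ℝ} {κ a' Λ : ℝ}

/-- the conjugation error of the gradient: `c₁ = 2√d·|κ|·e^{|κ|}`. [folklore] -/
def c1 (d : ℕ) (κ : ℝ) : ℝ := 2 * Real.sqrt d * |κ| * Real.exp |κ|

/-- `c₁ ≥ 0`. [folklore] -/
theorem c1_nonneg (d : ℕ) (κ : ℝ) : 0 ≤ c1 d κ := by unfold c1; positivity

/-- **`‖cG′‖ ≤ 1/γw`**, `γw = γ′ − Jfree > 0`. [folklore] -/
theorem opNorm_conjMat_Gps_le (ha' : 0 < a') (hlip : ∀ x ν, |ρ₀ (x + unitVec (fine n M) ν) - ρ₀ x| ≤ 1 / n)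
    (hosc : ∀ x x', blockOf n M x = blockOf n M x' → |ρ₀ x - ρ₀ x'| ≤ Λ) (hγ : Jfree d a' κ Λ < gammaPs d a') :
    ‖conjMat κ ρ₀ ρ₀ (Gps n M a')‖ ≤ (gammaPs d a' - Jfree d a' κ Λ)⁻¹ :=
  opNorm_conjMat_inv_le' (wCoercive_DeltaPs n M ha' hlip hosc) (by linarith)

/-- **`‖∂·cG′‖ ≤ √(1/γw + J/γw²)`**. [folklore] -/
theorem opNorm_GradOp_conjMat_Gps_le (ha' : 0 < a') (hlip : ∀ x ν, |ρ₀ (x + unitVec (fine n M) ν) - ρ₀ x| ≤ 1 / n)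
    (hosc : ∀ x x', blockOf n M x = blockOf n M x' → |ρ₀ x - ρ₀ x'| ≤ Λ) (hγ : Jfree d a' κ Λ < gammaPs d a') :
    ‖GradOp (fine n M) ((n : ℕ) : ℂ) * conjMat κ ρ₀ ρ₀ (Gps n M a')‖
      ≤ Real.sqrt (1 / (gammaPs d a' - Jfree d a' κ Λ) + Jfree d a' κ Λ / (gammaPs d a' - Jfree d a' κ Λ) ^ 2) :=
  opNorm_X_conjMat_inv_le (DeltaPs_eq_gram n M a') (smul_PiS_posSemidef n M a' ha'.le) (wCoercive_DeltaPs n M ha' hlip hosc) (by linarith)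
    (conjDefect_DeltaPs n M ha'.le hlip hosc) (Jfree_nonneg d ha'.le κ Λ)

/-- **`‖c(∂G′)‖ ≤ √(1/γw + J/γw²) + c₁/γw`** (bond weight on the left, site weight on the right). [folklore] -/
theorem opNorm_conjMat_GradOp_Gps_le (ha' : 0 < a') (hlip : ∀ x ν, |ρ₀ (x + unitVec (fine n M) ν) - ρ₀ x| ≤ 1 / n)
    (hosc : ∀ x x', blockOf n M x = blockOf n M x' → |ρ₀ x - ρ₀ x'| ≤ Λ) (hγ : Jfree d a' κ Λ < gammaPs d a') :
    ‖conjMat κ (bondW₀ n M ρ₀) ρ₀ (GradOp (fine n M) ((n : ℕ) : ℂ) * Gps n M a')‖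
      ≤ Real.sqrt (1 / (gammaPs d a' - Jfree d a' κ Λ) + Jfree d a' κ Λ / (gammaPs d a' - Jfree d a' κ Λ) ^ 2)
        + c1 d κ / (gammaPs d a' - Jfree d a' κ Λ) :=
  opNorm_conjMat_X_inv_le (DeltaPs_eq_gram n M a') (smul_PiS_posSemidef n M a' ha'.le) (wCoercive_DeltaPs n M ha' hlip hosc) (by linarith)
    (conjDefect_DeltaPs n M ha'.le hlip hosc) (Jfree_nonneg d ha'.le κ Λ) (opNorm_conjMat_GradOp_sub_le n M κ hlip)

/-- **`‖c(G′∂ᴴ)‖ ≤ K₂`**. [folklore] -/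
theorem opNorm_conjMat_Gps_GradOpH_le (ha' : 0 < a') (hlip : ∀ x ν, |ρ₀ (x + unitVec (fine n M) ν) - ρ₀ x| ≤ 1 / n)
    (hosc : ∀ x x', blockOf n M x = blockOf n M x' → |ρ₀ x - ρ₀ x'| ≤ Λ) (hγ : Jfree d a' κ Λ < gammaPs d a') :
    ‖conjMat κ ρ₀ (bondW₀ n M ρ₀) (Gps n M a' * (GradOp (fine n M) ((n : ℕ) : ℂ))ᴴ)‖
      ≤ K2 (gammaPs d a' - Jfree d a' κ Λ) (Jfree d a' κ Λ) (c1 d κ) :=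
  opNorm_conjMat_inv_XH_le (DeltaPs_eq_gram n M a') (smul_PiS_posSemidef n M a' ha'.le) (wCoercive_DeltaPs n M ha' hlip hosc) (by linarith)
    (conjDefect_DeltaPs n M ha'.le hlip hosc) (Jfree_nonneg d ha'.le κ Λ) (opNorm_conjMat_GradOpH_sub_le n M κ hlip)

/-- **`‖∂·c(G′∂ᴴ)‖ ≤ K₁`**. [folklore] -/
theorem opNorm_GradOp_conjMat_Gps_GradOpH_le (ha' : 0 < a') (hlip : ∀ x ν, |ρ₀ (x + unitVec (fine n M) ν) - ρ₀ x| ≤ 1 / n)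
    (hosc : ∀ x x', blockOf n M x = blockOf n M x' → |ρ₀ x - ρ₀ x'| ≤ Λ) (hγ : Jfree d a' κ Λ < gammaPs d a') :
    ‖GradOp (fine n M) ((n : ℕ) : ℂ) * conjMat κ ρ₀ (bondW₀ n M ρ₀) (Gps n M a' * (GradOp (fine n M) ((n : ℕ) : ℂ))ᴴ)‖
      ≤ K1 (gammaPs d a' - Jfree d a' κ Λ) (Jfree d a' κ Λ) (c1 d κ) :=
  opNorm_X_conjMat_inv_XH_le (DeltaPs_eq_gram n M a') (smul_PiS_posSemidef n M a' ha'.le) (wCoercive_DeltaPs n M ha' hlip hosc) (by linarith)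
    (conjDefect_DeltaPs n M ha'.le hlip hosc) (Jfree_nonneg d ha'.le κ Λ) (opNorm_conjMat_GradOpH_sub_le n M κ hlip)

/-- **`‖c(∂G′∂ᴴ)‖ ≤ K₁ + c₁K₂`** (bond weights on both sides). [folklore] -/
theorem opNorm_conjMat_GradOp_Gps_GradOpH_le (ha' : 0 < a') (hlip : ∀ x ν, |ρ₀ (x + unitVec (fine n M) ν) - ρ₀ x| ≤ 1 / n)
    (hosc : ∀ x x', blockOf n M x = blockOf n M x' → |ρ₀ x - ρ₀ x'| ≤ Λ) (hγ : Jfree d a' κ Λ < gammaPs d a') :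
    ‖conjMat κ (bondW₀ n M ρ₀) (bondW₀ n M ρ₀) (GradOp (fine n M) ((n : ℕ) : ℂ) * (Gps n M a' * (GradOp (fine n M) ((n : ℕ) : ℂ))ᴴ))‖
      ≤ K1 (gammaPs d a' - Jfree d a' κ Λ) (Jfree d a' κ Λ) (c1 d κ) + c1 d κ * K2 (gammaPs d a' - Jfree d a' κ Λ) (Jfree d a' κ Λ) (c1 d κ) :=
  opNorm_conjMat_X_inv_XH_le (DeltaPs_eq_gram n M a') (smul_PiS_posSemidef n M a' ha'.le) (wCoercive_DeltaPs n M ha' hlip hosc) (by linarith)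
    (conjDefect_DeltaPs n M ha'.le hlip hosc) (Jfree_nonneg d ha'.le κ Λ) (opNorm_conjMat_GradOp_sub_le n M κ hlip)
    (opNorm_conjMat_GradOpH_sub_le n M κ hlip)

end Bounds

end Summit.QuantumFields.BalabanUV.T4Continuum.CTScalarGreen

end
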